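import Summits.QuantumAdvantage.QuantumAdvantage.Theorems.LinnikCubicClassGroupsDegreeOnePrimesEscapeQuarticS4Count
import Summits.QuantumAdvantage.QuantumAdvantage.Theorems.LinnikCubicClassGroupsDegreeOnePrimesEscapeCubicSplittingPrimes
import Mathlib.GroupTheory.SpecificGroups.Cyclic
import HarnessLib

/-!
# The least inert prime of a cyclic field of prime-power degree is `≤ |d_K|^L` — by upper bounds only

Topic `Summits/QuantumAdvantage/QuantumAdvantage/Theorems`, cell B2b-1 (linnik-cubic), PART A (gen 8);
helper toward the crux `DegreeOnePrimesEscape` (stmt-QuantumAdvantage-11543) of route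
`LinnikCubicClassGroups`.  HONEST FRAMING: the value of this file is a THEOREM (kernel-checked, GRH-free,
Siegel-free, no hypothesis) — NOT summit progress.

**Theorem** (`exists_inertPrime_le_of_isCyclic`).  For every prime power `n = ℓ^k > 1` there is
`L = L(n) > 0` such that every Galois number field `K` of degree `n` with CYCLIC Galois group has a
rational prime `p ≤ |d_K|^{L}` that is inert in `K` (`p𝓞_K` prime, i.e. `Frob_p` generates `Gal(K/ℚ)`).
Cases: every quadratic field (`n = 2`, the least quadratic non-residue-type prime, Vinogradov–Linnik),
cyclic cubic (`…CubicSplittingPrimes.lean`, here reproved), cyclic quartic, quintic, … fields.  (A cyclic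
group of non-prime-power order, or a non-cyclic group, has no inert primes at all.)

Proof — ONE-SIDED.  Let `M < G = Gal(K/ℚ)` be the subgroup of index `ℓ` and `k₁ = K^M` (degree `ℓ`).
An element of the cyclic `ℓ`-group `G` generates it iff it lies outside `M`, so with
`a_{k₁}(p) = #{𝔭 ∣ p in k₁ : f = 1} ∈ {0, ℓ}`:  `ℓ·𝟙[p inert in K] = ℓ − a_{k₁}(p)` at `p ∤ d_K`
(`cyclic_dictionary`, through Perlis' unramified dictionary (★) — with `m = f` for every residue degree
`f` to certify inertness, `le_of_mem_splittingType_of_pow_ne_one`).  Summing over `p ≤ x`,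
`ℓ θ(x) − θ¹_{k₁}(x) − ℓ log|d_K| ≤ ℓ Σ_{p ≤ x inert} log p`, and ONLY `θ(x) ≥ (1−η)x` and the UPPER
bound `θ_{k₁}(x) ≤ (1+η)x` (`chebyshevThetaIdeal_le_uniform`, uniform for `x ≥ Q_{k₁}^{a(ℓ,η)}`) are
needed: `ℓ(1−η) − (1+η) > 0`.

Placement: classical (Vinogradov–Linnik for `n = 2`; P. D. T. A. Elliott, least prime `k`-th power
non-residues; P. Pollack, prime splitting in abelian fields; Cho–Lemke Oliver–Zaman arXiv:2512.24963
Remark 2) — all with explicit exponents via Kronecker–Weber and character sums.  New here is only the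
kernel-checked, Kronecker–Weber-free proof with an inexplicit exponent.

References: J. C. Lagarias, H. L. Montgomery, A. M. Odlyzko, Invent. Math. 54 (1979)
[LagariasMontgomeryOdlyzko1979]; R. Perlis, J. Number Theory 9 (1977) [Perlis1977]; J. Thorner, A. Zaman,
Algebra Number Theory 13 (2019) [ThornerZaman2019].
-/

noncomputable section

open scoped NumberField nonZeroDivisors
open Finset Real Ideal NumberField
open Literature.NumberTheory.NumberFields Literature.NumberTheory.LFunctions
  Literature.NumberTheory.LFunctions.NumberField

namespace Summit.QuantumAdvantage.QuantumAdvantage.Theorems.DegreeOnePrimesEscape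

/-! ### The dictionary for generators of the Galois group -/

section Dictionary

variable {N : Type} [Field N] [NumberField N] [IsGalois ℚ N]

omit [IsGalois ℚ N] in
/-- The splitting type of `p` in the top intermediate field is that of `p` in `N`. -/
theorem splittingType_top {p : ℕ} (hp : p.Prime) :
    splittingType (⊤ : IntermediateField ℚ N) p = splittingType N p :=
  ArithmeticallyEquivalent.of_algEquiv (IntermediateField.topEquiv (F := ℚ) (E := N)) p hp

/-- **Residue degrees at a prime whose Frobenius has order `≥ n`**: if `φ` is an arithmetic Frobenius
at `Q₀ ∣ p` with trivial inertia and `φ^m ≠ 1` for `0 < m < n`, then every prime of `N` above `p` has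
residue degree `≥ n` ((★) with `E = N`, `m = f`: `Σ_{f' ∣ f} f' = #{g : φ^f = 1}`). -/
theorem le_of_mem_splittingType_of_pow_ne_one {p : ℕ} (hp : p.Prime) (Q₀ : Ideal (𝓞 N))
    [Q₀.IsMaximal] [Q₀.LiesOver (span {(p : ℤ)})] {φ : N ≃ₐ[ℚ] N} (hφ : IsArithFrobAt ℤ φ Q₀)
    (hI : Q₀.inertia (N ≃ₐ[ℚ] N) = ⊥) {n : ℕ} (hgen : ∀ m : ℕ, 0 < m → m < n → φ ^ m ≠ 1)
    {f : ℕ} (hf : f ∈ splittingType N p) : n ≤ f := by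
  by_contra hlt
  push Not at hlt
  have hf0 : 0 < f := splittingType_pos hp hf
  have h := card_fixingSubgroup_mul_sum_filter_dvd (⊤ : IntermediateField ℚ N) hp Q₀ hφ hI f
  rw [IntermediateField.fixingSubgroup_top, Subgroup.card_bot, one_mul, splittingType_top hp] at h
  have hzero : Nat.card {g : N ≃ₐ[ℚ] N // g * φ ^ f * g⁻¹ ∈ (⊥ : Subgroup (N ≃ₐ[ℚ] N))} = 0 := by
    rw [Nat.card_eq_zero]
    left
    refine ⟨fun g => hgen f hf0 hlt ?_⟩
    have hg := Subgroup.mem_bot.mp g.2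
    have : φ ^ f = g.1⁻¹ * (g.1 * φ ^ f * g.1⁻¹) * g.1 := by group
    rw [this, hg, mul_one, inv_mul_cancel]
  rw [hzero] at h
  have hmem : f ∈ (splittingType N p).filter (· ∣ f) := Multiset.mem_filter.mpr ⟨hf, dvd_refl f⟩
  have hle : f ≤ ((splittingType N p).filter (· ∣ f)).sum := Multiset.le_sum_of_mem hmem
  omega

/-- **The one-sided dictionary for generators.** Let `M ≤ Gal(N/ℚ)` be a normal subgroup such that
every element outside `M` has `φ^m ≠ 1` for `0 < m < [N:ℚ]` (e.g. `Gal(N/ℚ)` cyclic of prime-power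
order and `M` its maximal subgroup).  Then at every prime `p ∤ d_N`:
`[G:M] ≤ a_{N^M}(p) + [G:M]·𝟙[every residue degree of p in N is ≥ [N:ℚ]]`. -/
theorem cyclic_dictionary (M : Subgroup (N ≃ₐ[ℚ] N)) (hM : ∀ φ ∈ M, ∀ g : N ≃ₐ[ℚ] N, g * φ * g⁻¹ ∈ M)
    (hgen : ∀ φ : N ≃ₐ[ℚ] N, φ ∉ M → ∀ m : ℕ, 0 < m → m < Module.finrank ℚ N → φ ^ m ≠ 1)
    {p : ℕ} (hp : p.Prime) (hd : ¬ (p : ℤ) ∣ NumberField.discr N) :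
    M.index ≤ (splittingType (IntermediateField.fixedField M) p).count 1 +
      M.index * (if ∀ f ∈ splittingType N p, Module.finrank ℚ N ≤ f then 1 else 0) := by
  classical
  obtain ⟨Q₀, hQ₀max, hQ₀over, ⟨φ, hφ⟩, hI⟩ := exists_isArithFrobAt_of_not_dvd_discr (N := N) hp hd
  by_cases hφM : φ ∈ M
  · have h := card_fixingSubgroup_mul_count_one_splittingType (IntermediateField.fixedField M) hp Q₀ hφ hI
    rw [natCard_fixingSubgroup_fixedField] at h
    simp only [IntermediateField.fixingSubgroup_fixedField] at h
    have hall : Nat.card {g : N ≃ₐ[ℚ] N // g * φ * g⁻¹ ∈ M} = Nat.card (N ≃ₐ[ℚ] N) :=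
      Nat.card_congr (Equiv.subtypeUnivEquiv fun g => hM φ hφM g)
    rw [hall, ← Subgroup.card_mul_index M] at h
    have hMpos : 0 < Nat.card M := Nat.card_pos
    have hidx : (splittingType (IntermediateField.fixedField M) p).count 1 = M.index :=
      Nat.eq_of_mul_eq_mul_left hMpos h
    rw [hidx]
    exact Nat.le_add_right _ _
  · have hall : ∀ f ∈ splittingType N p, Module.finrank ℚ N ≤ f := fun f hf =>
      le_of_mem_splittingType_of_pow_ne_one hp Q₀ hφ hI (hgen φ hφM) hf
    rw [if_pos hall, mul_one]
    exact Nat.le_add_left _ _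

/-- **Summed**: `[G:M] θ(x) − θ¹_{N^M}(x) − [G:M] log|d_N| ≤ [G:M] Σ_{p ≤ x, p ∤ d_N, p inert in N} log p`,
"inert" recorded as "every residue degree `≥ [N:ℚ]`". -/
theorem cyclic_inertSum_ge (M : Subgroup (N ≃ₐ[ℚ] N)) (hM : ∀ φ ∈ M, ∀ g : N ≃ₐ[ℚ] N, g * φ * g⁻¹ ∈ M)
    (hgen : ∀ φ : N ≃ₐ[ℚ] N, φ ∉ M → ∀ m : ℕ, 0 < m → m < Module.finrank ℚ N → φ ^ m ≠ 1)
    (x : ℝ) :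
    M.index * Chebyshev.theta x - degreeOneTheta (IntermediateField.fixedField M) x -
        M.index * Real.log ((NumberField.discr N).natAbs : ℝ) ≤
      M.index * ∑ p ∈ (Nat.primesLE ⌊x⌋₊).filter
        (fun p : ℕ => ¬ ((p : ℤ) ∣ NumberField.discr N) ∧
          ∀ f ∈ splittingType N p, Module.finrank ℚ N ≤ f), Real.log p := by
  classical
  set G : ℝ := (M.index : ℝ) with hG
  have hG0 : 0 ≤ G := Nat.cast_nonneg _
  have h := sum_le_of_pointwise (N := N) G hG0
    (fun p => G - (((splittingType (IntermediateField.fixedField M) p).count 1 : ℕ) : ℝ))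
    (fun p => ∀ f ∈ splittingType N p, Module.finrank ℚ N ≤ f) ⌊x⌋₊ ?_ ?_
  · rw [Chebyshev.theta_eq_sum_primesLE, degreeOneTheta_eq_sum_count_one]
    refine le_trans (le_of_eq ?_) h
    rw [Finset.mul_sum, ← Finset.sum_sub_distrib]
    refine congrArg₂ _ (Finset.sum_congr rfl fun p _ => by ring) rfl
  · intro p hp hd
    have hp' := (Nat.mem_primesLE.mp hp).2
    have hdict := cyclic_dictionary M hM hgen hp' hd
    split_ifs at hdict ⊢ with h0
    · rw [mul_one] at hdict
      have : (M.index : ℝ) ≤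
          (((splittingType (IntermediateField.fixedField M) p).count 1 : ℕ) : ℝ) + M.index := by
        exact_mod_cast hdict
      rw [hG]; linarith
    · rw [mul_zero, add_zero] at hdict
      have : (M.index : ℝ) ≤
          (((splittingType (IntermediateField.fixedField M) p).count 1 : ℕ) : ℝ) := by
        exact_mod_cast hdict
      rw [hG]; linarith
  · intro p _ _
    have h1 : (0 : ℝ) ≤
        (((splittingType (IntermediateField.fixedField M) p).count 1 : ℕ) : ℝ) := Nat.cast_nonneg _
    linarith

end Dictionary

/-! ### Cyclic `ℓ`-groups: the maximal subgroup -/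

/-- **The maximal subgroup of a cyclic group of order `ℓ^k`.** If `G` is cyclic of order `ℓ^k`
(`ℓ` prime, `k ≠ 0`) then `M = ⟨g^ℓ⟩` (for a generator `g`) has order `ℓ^{k-1}` and index `ℓ`, is
normal, and every element outside `M` has order `ℓ^k`: `x^m ≠ 1` for `0 < m < ℓ^k`. -/
theorem exists_maximal_subgroup_of_isCyclic {G : Type*} [Group G] [Finite G] (hG : IsCyclic G)
    {ℓ k : ℕ} (hℓ : ℓ.Prime) (hk : k ≠ 0) (hcard : Nat.card G = ℓ ^ k) :
    ∃ M : Subgroup G, M.index = ℓ ∧ Nat.card M = ℓ ^ (k - 1) ∧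
      (∀ φ ∈ M, ∀ g : G, g * φ * g⁻¹ ∈ M) ∧
      ∀ φ : G, φ ∉ M → ∀ m : ℕ, 0 < m → m < ℓ ^ k → φ ^ m ≠ 1 := by
  classical
  obtain ⟨g, hg⟩ := IsCyclic.exists_generator (α := G)
  have hog : orderOf g = ℓ ^ k := (orderOf_eq_card_of_forall_mem_zpowers hg).trans hcard
  have hcomm : ∀ a b : G, a * b = b * a := fun a b => hG.isMulCommutative.is_comm.comm a b
  set M := Subgroup.zpowers (g ^ ℓ) with hM
  have hℓdvd : ℓ ∣ orderOf g := by
    rw [hog]; exact dvd_pow_self ℓ hk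
  have hMcard : Nat.card M = ℓ ^ (k - 1) := by
    rw [hM, Nat.card_zpowers, orderOf_pow_of_dvd hℓ.ne_zero hℓdvd, hog]
    have hpow : ℓ ^ k = ℓ ^ (k - 1) * ℓ := by
      rw [← pow_succ, Nat.sub_add_cancel (Nat.one_le_iff_ne_zero.mpr hk)]
    rw [hpow, Nat.mul_div_cancel _ hℓ.pos]
  have hidx : M.index = ℓ := by
    have h := Subgroup.card_mul_index M
    rw [hcard, hMcard] at h
    have hpow : ℓ ^ (k - 1) * ℓ = ℓ ^ k := by
      rw [← pow_succ, Nat.sub_add_cancel (Nat.one_le_iff_ne_zero.mpr hk)]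
    rw [← hpow] at h
    exact Nat.eq_of_mul_eq_mul_left (pow_pos hℓ.pos _) h
  refine ⟨M, hidx, hMcard, fun φ _ a => ?_, fun φ hφ m hm0 hm => ?_⟩
  · rw [hcomm a φ, mul_inv_cancel_right]; assumption
  · -- `φ = g^j` with `ℓ ∤ j`, so `φ` has order `ℓ^k`
    have hφg : φ ∈ Subgroup.zpowers g := hg φ
    rw [mem_zpowers_iff_mem_range_orderOf, Finset.mem_image] at hφg
    obtain ⟨j, hj, rfl⟩ := hφg
    have hj0 : j ≠ 0 := by
      rintro rfl
      exact hφ (by rw [pow_zero]; exact M.one_mem)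
    have hndvd : ¬ ℓ ∣ j := by
      rintro ⟨t, rfl⟩
      exact hφ (by rw [pow_mul]; exact Subgroup.pow_mem _ (Subgroup.mem_zpowers _) t)
    have hcop : Nat.Coprime (ℓ ^ k) j :=
      Nat.Coprime.pow_left k ((Nat.Prime.coprime_iff_not_dvd hℓ).mpr hndvd)
    have horder : orderOf (g ^ j) = ℓ ^ k := by
      rw [orderOf_pow' g hj0, hog, Nat.Coprime.gcd_eq_one hcop, Nat.div_one]
    exact pow_ne_one_of_lt_orderOf hm0.ne' (horder ▸ hm)

/-! ### The theorem -/

/-- `ℓ^ℓ ≤ d^{ℓ²}` for `d ≥ 3`. -/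
private theorem pow_self_le_pow_sq {ℓ : ℕ} {d : ℝ} (hd : 3 ≤ d) : (ℓ : ℝ) ^ ℓ ≤ d ^ (ℓ * ℓ) := by
  have hℓ : (ℓ : ℝ) ≤ d ^ ℓ := by
    have h1 : (ℓ : ℝ) < 2 ^ ℓ := by exact_mod_cast Nat.lt_two_pow_self
    have h2 : (2 : ℝ) ^ ℓ ≤ d ^ ℓ := pow_le_pow_left₀ (by norm_num) (by linarith) ℓ
    linarith
  calc (ℓ : ℝ) ^ ℓ ≤ (d ^ ℓ) ^ ℓ := pow_le_pow_left₀ (Nat.cast_nonneg _) hℓ ℓ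
    _ = d ^ (ℓ * ℓ) := by rw [← pow_mul]

set_option maxHeartbeats 800000 in
/-- **The least inert prime of a cyclic field of prime-power degree, unconditionally.** For every
prime power `n = ℓ^k` (`k ≠ 0`) there is `L > 0` such that every Galois number field `K` of degree
`n` with cyclic Galois group has a rational prime `p ≤ |d_K|^{L}` with `p𝓞_K` prime (`Frob_p`
generates `Gal(K/ℚ)`; density `1 − 1/ℓ`).  Includes every quadratic field (`ℓ = 2`, `k = 1`).
GRH-free, Siegel-free, no hypothesis; proved with the UPPER bound for the degree-`ℓ` subfield only.
[cite: LagariasMontgomeryOdlyzko1979, Theorem 1.1] -/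
theorem exists_inertPrime_le_of_isCyclic (ℓ k : ℕ) (hℓ : ℓ.Prime) (hk : k ≠ 0) :
    ∃ L : ℝ, 0 < L ∧ ∀ (K : Type) [Field K] [NumberField K] [IsGalois ℚ K],
      IsCyclic (K ≃ₐ[ℚ] K) → Module.finrank ℚ K = ℓ ^ k →
        ∃ p : ℕ, p.Prime ∧ (p : ℝ) ≤ ((NumberField.discr K).natAbs : ℝ) ^ L ∧
          (Ideal.span {(p : 𝓞 K)}).IsPrime := by
  classical
  have hℓ2 : 2 ≤ ℓ := hℓ.two_le
  -- constants
  obtain ⟨a, ha1, hup⟩ := chebyshevThetaIdeal_le_uniform ℓ hℓ.one_lt (η := 1 / 26) (by norm_num)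
  obtain ⟨x₀, hx₀2, hθQ⟩ := chebyshevTheta_eventually_ge (η := 1 / 26) (by norm_num)
  obtain ⟨L, hL, hthr⟩ := exists_exponent_rpow (1 + ℓ * ℓ) a x₀ 52 (by positivity) (by linarith)
  refine ⟨L, hL, fun K _ _ _ hcyc hn => ?_⟩
  -- the maximal subgroup and its fixed field
  have hcardG : Nat.card (K ≃ₐ[ℚ] K) = ℓ ^ k := by rw [IsGalois.card_aut_eq_finrank, hn]
  obtain ⟨M, hidx, hMcard, hM, hgen⟩ := exists_maximal_subgroup_of_isCyclic hcyc hℓ hk hcardG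
  rw [← hn] at hgen
  set k₁ := IntermediateField.fixedField M with hk₁_def
  have hk₁ : Module.finrank ℚ k₁ = ℓ := by
    have h1 : Module.finrank k₁ K = ℓ ^ (k - 1) := by
      rw [hk₁_def, IntermediateField.finrank_fixedField_eq_card, hMcard]
    have h2 := Module.finrank_mul_finrank ℚ k₁ K
    rw [h1, hn] at h2
    have hpow : ℓ * ℓ ^ (k - 1) = ℓ ^ k := by
      rw [← pow_succ', Nat.sub_add_cancel (Nat.one_le_iff_ne_zero.mpr hk)]
    rw [← hpow] at h2
    exact Nat.eq_of_mul_eq_mul_right (pow_pos hℓ.pos _) h2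
  -- sizes
  set d : ℝ := ((NumberField.discr K).natAbs : ℝ) with hd
  have hn1 : 1 < Module.finrank ℚ K := by
    rw [hn]; exact Nat.one_lt_pow hk hℓ.one_lt
  have hd3 : (3 : ℝ) ≤ d := three_le_natAbs_discr_real K hn1
  have hd0 : (0 : ℝ) < d := by linarith
  have hd1 : (1 : ℝ) ≤ d := by linarith
  obtain ⟨hx₀, hxQ, hxB⟩ := hthr d hd3
  set x : ℝ := d ^ L with hx
  -- the conductor of `k₁`: `Q_{k₁} = |d_{k₁}| ℓ^ℓ ≤ d · d^{ℓ²}`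
  have hdk₁ : ((NumberField.discr k₁).natAbs : ℝ) ≤ d := by
    have hdvd := NumberField.discr_dvd_discr k₁ K
    rw [hd]
    exact_mod_cast Nat.le_of_dvd (Int.natAbs_pos.mpr (NumberField.discr_ne_zero K))
      (Int.natAbs_dvd_natAbs.mpr hdvd)
  have hQ : ThornerZaman.condQn k₁ ≤ d ^ ((1 : ℝ) + ℓ * ℓ) := by
    rw [ThornerZaman.condQn, hk₁, ← Int.cast_abs, Int.abs_eq_natAbs, Int.cast_natCast,
      show (1 : ℝ) + ℓ * ℓ = (((1 + ℓ * ℓ : ℕ)) : ℝ) by push_cast; ring, Real.rpow_natCast,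
      pow_add, pow_one]
    exact mul_le_mul hdk₁ (pow_self_le_pow_sq hd3) (by positivity) hd0.le
  have hQa : ThornerZaman.condQn k₁ ^ a ≤ x := by
    have hQ0 : 0 ≤ ThornerZaman.condQn k₁ := by rw [ThornerZaman.condQn]; positivity
    exact (Real.rpow_le_rpow hQ0 hQ (by linarith)).trans hxQ
  -- the analytic inputs at `x`
  have hx0 : 0 ≤ x := by positivity
  have hθ : 25 / 26 * x ≤ Chebyshev.theta x := by
    have := hθQ x hx₀; norm_num at this ⊢; linarith
  have hθk : degreeOneTheta k₁ x ≤ 27 / 26 * x := by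
    have := (degreeOneTheta_le_chebyshevThetaIdeal k₁ x).trans (hup k₁ hk₁ x hQa)
    norm_num at this ⊢; linarith
  have hlog : Real.log d ≤ x / 52 := by
    have hlogd : Real.log d ≤ d := (Real.log_le_sub_one_of_pos hd0).trans (by linarith)
    linarith
  -- the sum
  have hsum := cyclic_inertSum_ge M hM hgen x
  rw [hidx] at hsum
  have hℓ0 : (0 : ℝ) ≤ ℓ := Nat.cast_nonneg ℓ
  have hℓ2' : (2 : ℝ) ≤ ℓ := by exact_mod_cast hℓ2
  have hA : 25 / 26 * ((ℓ : ℝ) * x) ≤ ℓ * Chebyshev.theta x := by nlinarith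
  have hC : (ℓ : ℝ) * Real.log d ≤ 1 / 52 * ((ℓ : ℝ) * x) := by nlinarith
  have hD : 2 * x ≤ (ℓ : ℝ) * x := by nlinarith
  have hpos : 0 < ∑ p ∈ (Nat.primesLE ⌊x⌋₊).filter
      (fun p : ℕ => ¬ ((p : ℤ) ∣ NumberField.discr K) ∧
        ∀ f ∈ splittingType K p, Module.finrank ℚ K ≤ f), Real.log p := by
    have hx1 : 0 < x := by positivity
    have hℓS : 0 < (ℓ : ℝ) * ∑ p ∈ (Nat.primesLE ⌊x⌋₊).filter
        (fun p : ℕ => ¬ ((p : ℤ) ∣ NumberField.discr K) ∧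
          ∀ f ∈ splittingType K p, Module.finrank ℚ K ≤ f), Real.log p := by
      rw [hd] at hC
      linarith
    exact pos_of_mul_pos_right hℓS hℓ0  -- hmm: need variant for left factor
  obtain ⟨p, hp, hpx, hpN, hall⟩ := exists_prime_of_sum_log_pos hpos
  refine ⟨p, hp, hpx, isPrime_span_of_forall_finrank_lt_two_mul hp hpN fun f hf => ?_⟩
  have := hall f hf
  omega

/-- **The least inert prime of a quadratic field, unconditionally** (the case `n = 2`: the least prime
`p ≤ |d_K|^L` with `(d_K/p) = −1`; Vinogradov–Linnik). [cite: LagariasMontgomeryOdlyzko1979, Theorem 1.1] -/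
theorem exists_inertPrime_le_of_quadratic :
    ∃ L : ℝ, 0 < L ∧ ∀ (K : Type) [Field K] [NumberField K], Module.finrank ℚ K = 2 →
      ∃ p : ℕ, p.Prime ∧ (p : ℝ) ≤ ((NumberField.discr K).natAbs : ℝ) ^ L ∧
        (Ideal.span {(p : 𝓞 K)}).IsPrime := by
  obtain ⟨L, hL, h⟩ := exists_inertPrime_le_of_isCyclic 2 1 Nat.prime_two one_ne_zero
  refine ⟨L, hL, fun K _ _ h2 => ?_⟩
  haveI : Algebra.IsQuadraticExtension ℚ K := ⟨h2⟩
  haveI : IsGalois ℚ K := inferInstance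
  haveI : Fact (Nat.Prime 2) := ⟨Nat.prime_two⟩
  have hc : IsCyclic (K ≃ₐ[ℚ] K) :=
    isCyclic_of_prime_card (p := 2) (by rw [IsGalois.card_aut_eq_finrank, h2])
  exact h K hc (by rw [h2]; norm_num)

end Summit.QuantumAdvantage.QuantumAdvantage.Theorems.DegreeOnePrimesEscape

end
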